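import Summits.BirchSwinnertonDyer.BirchSwinnertonDyer.Theorems.ByReductionTypeAtTwoTorsionEulerCharH46AtPStrict
import Summits.BirchSwinnertonDyer.BirchSwinnertonDyer.Theorems.ThetaPartnerAtTwoSignedMainConjectureCMTwoRankZeroPTDeepSelmerTransport
import Literature.NumberTheory.GaloisRepresentations.ShapiroLocalDualityOpenSubgroup
import Literature.NumberTheory.GaloisRepresentations.ContinuousCupProductCompatMixed
import Literature.NumberTheory.EllipticCurves.TorsionFilAtCardProofs
import Literature.NumberTheory.EllipticCurves.TorsionFilAtCyclicOfFrobeniusTraceProofs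
import Literature.NumberTheory.EllipticCurves.ConjugatePairingRestrictedPerfectProofs
import Literature.NumberTheory.GaloisCohomology.ArchimedeanInvariantMap
import HarnessLib

set_option linter.dupNamespace false -- `…BirchSwinnertonDyer.BirchSwinnertonDyer…` is the cell's nested layout (D-0017)
set_option autoImplicit false

/-!
# H46 kernel programme (road C′), the socket at `p`, DUAL side: a dual class orthogonal to the LAYER-local Greenberg condition
# `Lp` is STRICT at `p` — «the Lagrangian `C_p[p^k]` is its own annihilator at every layer», where ORDINARITY enters

Cell `bsd-2adic` (run/shared/lean/pub/bsd-2adic/), seat `bsd-2adic-tower-1` GEN 35; `--supports stmt-BirchSwinnertonDyer-19271`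
(helper, item `OrdKatoHalfAtTwo`, TOWER road). THEOREMS ONLY (no definition, no named fact, no instance, no `sorry`); closes no item;
nothing booked; BSD is not proved by any of this.

This is the `hLdual` half of socket (HP) of `TorsionEulerChar.H46Assembly.exists_realiser_of_sockets` (p735305), in the currency fixed
by the sibling `…H46AtPStrict.lean`:

  `Lp p = comap pull_p (map Sh_loc (ker (H¹(U_n, E[p^k]|) → H¹(U_n, E[p^k]| ⧸ C_p[p^k]))))`,  `Λp p b := b ∈ (C_p[p^k]-datum).strictKer Γ_n`.

**`mem_strictKer_of_localization_coindTateDual_mem_dualLocalCondition`**: if the localisation at `p` of the dual class `Ψ_*(Sh b)` of a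
layer class `b ∈ H¹(Γ_n, E[p^k])` (`Ψ = coindTateDualMor` of THE Weil pairing `weilTowerPk`) is orthogonal to `Lp p` under THE local Tate
pairing (`LocalInvariants.canonical`), then `b` is STRICT at `p`. Proof:
* for a local class `c ∈ H¹(U_n, C_p[p^k])` put `x = ι_* c` (dies under `π_*`, `π ∘ ι = 0` on cocycles) and `a = pull_p⁻¹(Sh_loc x)`
  (`ThetaTransport.CoindShapiroOfFun.bijective_cohomologyMap_coindFinPull`, one orbit at `p`); `a ∈ Lp p`, so the pairing vanishes;
* RTT's dictionary `localTatePairingZMod_canonical_localization_coindTateDual_shapiroLift` rewrites it as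
  `inv_p (Sh_loc x ∪_{Σe} Sh_loc (loc_n b)) = 0`; THE invariant map is injective (`LocalInvariants.canonical_isPerfect`), and the
  μ-transport `muLocalIso` (projection formula `ContPairing.cupProduct_map_adjoint`) moves the cup product to the local coefficients
  `μ_{p^k}(ℚ̄_p)`;
* the LOCAL Lagrangian statement `cohomologyMap_eq_zero_of_forall_cupProduct_shapiroLift_range_eq_zero` (p729744 §2, local Tate duality for
  the open subgroup `U_n ≤ Γ_{ℚ_p}` with LOCAL coefficients `C_p[p^k] ↪ E[p^k]| ↠ E[p^k]|/C_p[p^k]`) gives `π_*(loc_n b) = 0`, and the sibling's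
  dictionary `mem_strictKer_of_cohomologyMap_mkQHom_layerLocOf_eq_zero` concludes.
The E-level inputs of the Lagrangian statement are where GOOD ORDINARY reduction at `p` enters: `C_p[p^k] = Fil_p E[p^k]` is isotropic for the
Weil pairing and `#C_p[p^k]² = #E[p^k]` (`TorsionFilAtCardProofs`, `TorsionFilAtCyclicOfFrobeniusTraceProofs`, from `p ∤ a_p`), whence
`C^⊥ = C` and every character of `C` is `e(·, x)|_C` (`ConjugatePairingRestrictedPerfectProofs`), i.e. the induced pairing
`C_p[p^k] × E[p^k]/C_p[p^k] → μ_{p^k}` is perfect on the right.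

HONEST FRAMING: plumbing over tree theorems; H46 is not proved in this file; BSD is not proved by any of this.

References: [GreenbergLNM1716] §2 pp. 73–75 (C_v, Props. 2.2/2.4), §4 Lemma 4.6 (p. 105); [Howard2004HeegnerKolyvagin] Lemma 3.1.1;
[MilneADT2006] I Cor. 2.3, I §0 Prop. 0.19; [NeukirchSchmidtWingberg2008] I §5 (1.5.3)(iv), §6 (1.6.4)–(1.6.5).
-/

noncomputable section

open scoped Classical NumberField

namespace Summit.BirchSwinnertonDyer.BirchSwinnertonDyer.Theorems

namespace TorsionEulerChar.H46AtP

open CategoryTheory Field NumberField IsDedekindDomain WeierstrassCurve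
  Literature.NumberTheory.EllipticCurves Literature.NumberTheory.EllipticCurves.CyclotomicLayer
  Literature.NumberTheory.EllipticCurves.GreenbergSelmer
  Literature.NumberTheory.GaloisRepresentations Literature.NumberTheory.GaloisRepresentations.DiscreteGaloisModule
  Literature.NumberTheory.GaloisCohomology ZpExtension
open _root_.TopRep _root_.ContinuousCohomology

/-! ## §1 Small inputs -/

section Inputs

variable (W : WeierstrassCurve ℚ) [W.IsElliptic] (p : ℕ) [hp : Fact p.Prime] (k : ℕ) (v : HeightOneSpectrum (𝓞 ℚ))

omit [W.IsElliptic] hp in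
/-- `Fil_v E[m]` of `ZpExtensionEisensteinOrdinaryFiltration` IS the `ℤ`-span of the plus part of the datum `C_v[m]` of p731663 (both read
«`ι P ∈ E₁(K̄_v)`» for the chosen embedding). [cite: GreenbergLNM1716, §2 p. 73] -/
theorem torsionFilAt_eq_toIntSubmodule_plus (m : ℤ) :
    W.torsionFilAt v m = AddSubgroup.toIntSubmodule (W.kernelOfReductionLocalDatumTorsion m v).plus :=
  SetLike.ext fun _ ↦ Iff.rfl

omit hp in
/-- THE local invariant map `inv_v : H²(Γ_{ℚ_v}, μ_N|) → ℤ/N` of the `CyclotomicLayer` currency is injective (local Tate duality,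
`LocalInvariants.canonical_isPerfect`). [cite: MilneADT2006, Ch. I Cor. 2.3] -/
theorem invAt_injective (N : ℕ) [NeZero N] : Function.Injective (invAt N v) :=
  (LocalInvariants.canonical_isPerfect (K := ℚ) (n := N) v).1.injective

omit [W.IsElliptic] hp in
/-- A `p^k`-torsion point, as an element of the subgroup `E[p^k]`, is killed by `p^k • ·`. [cite: SilvermanAEC2009, III §8] -/
theorem nsmul_geomTorsion_eq_zero (P : W.geomTorsion ((p : ℤ) ^ k)) : (p ^ k) • P = 0 := by
  apply Subtype.ext
  rw [AddSubmonoidClass.coe_nsmul, ZeroMemClass.coe_zero, ← natCast_zsmul, Nat.cast_pow]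
  exact (mem_geomTorsion_iff W _ _).mp P.2

end Inputs

/-! ## §2 The local pairing data at `p`: `e_loc = μ-transport ∘ Weil`, its descent `e'` to `C × E[p^k]/C`, right-perfect -/

section LocalPairing

variable (W : WeierstrassCurve ℚ) [W.IsElliptic] (p : ℕ) [hp : Fact p.Prime] (k : ℕ) (v : HeightOneSpectrum (𝓞 ℚ))
  (hpv : ((p : ℕ) : 𝓞 ℚ) ∈ v.asIdeal) (hgood : W.HasGoodReductionAt v) (hord : ¬ ((p : ℤ) ∣ W.frobeniusTraceAt v))

/-- **The Weil pairing followed by `μ_{p^k}(ℚ̄) → μ_{p^k}(ℚ̄_v)`** as a bi-additive map `E[p^k] × E[p^k] → μ_{p^k}(ℚ̄_v)`, `Γ_{ℚ_v}`-equivariant for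
the restricted actions (`contPairingOfFun.toLin_smul` and the equivariance of `muLocalIso`). [cite: MilneADT2006, Ch. I §2 Cor. 2.3]
[cite: SilvermanAEC2009, Prop. III.8.1 (d)] -/
theorem exists_localWeilPairing [NeZero (p ^ k)] :
    ∃ eL : W.geomTorsion ((p : ℤ) ^ k) →+ W.geomTorsion ((p : ℤ) ^ k) →+ MuCarrier (v.adicCompletion ℚ) (p ^ k),
      (∀ S T, eL S T = (muLocalIso (K := ℚ) v (p ^ k)).hom.hom
        (pairingHomOfFun (p ^ k) (weilTowerPk W k) (weilTowerPk_pow W k) (weilTowerPk_add_left W k) (weilTowerPk_add_right W k) S T)) ∧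
      ∀ (σ : absoluteGaloisGroup (v.adicCompletion ℚ)) (S T : W.geomTorsion ((p : ℤ) ^ k)),
        eL (GaloisRep.restrictField (v.adicCompletion ℚ) (W.torsionGaloisModule ((p : ℤ) ^ k)) σ S)
            (GaloisRep.restrictField (v.adicCompletion ℚ) (W.torsionGaloisModule ((p : ℤ) ^ k)) σ T) =
          mu (v.adicCompletion ℚ) (p ^ k) σ (eL S T) := by
  refine ⟨AddMonoidHom.mk' (fun S ↦ AddMonoidHom.mk' (fun T ↦ (muLocalIso (K := ℚ) v (p ^ k)).hom.hom
      (pairingHomOfFun (p ^ k) (weilTowerPk W k) (weilTowerPk_pow W k) (weilTowerPk_add_left W k) (weilTowerPk_add_right W k) S T))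
      (fun T₁ T₂ ↦ by rw [map_add, map_add])) (fun S₁ S₂ ↦ by ext T; simp only [map_add, AddMonoidHom.add_apply, AddMonoidHom.mk'_apply]),
    fun _ _ ↦ rfl, fun σ S T ↦ ?_⟩
  simp only [AddMonoidHom.mk'_apply]
  have h := (contPairingOfFun (W.torsionGaloisModule ((p : ℤ) ^ k)) (p ^ k) (weilTowerPk W k) (weilTowerPk_pow W k)
    (weilTowerPk_add_left W k) (weilTowerPk_add_right W k) (weilTowerPk_smul W k)).toLin_smul
    (absGaloisRestrict ℚ (v.adicCompletion ℚ) σ) S T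
  rw [contPairingOfFun_toLin_apply] at h
  have h' : pairingHomOfFun (p ^ k) (weilTowerPk W k) (weilTowerPk_pow W k) (weilTowerPk_add_left W k) (weilTowerPk_add_right W k)
      ((W.torsionGaloisModule ((p : ℤ) ^ k)) (absGaloisRestrict ℚ (v.adicCompletion ℚ) σ) S)
      ((W.torsionGaloisModule ((p : ℤ) ^ k)) (absGaloisRestrict ℚ (v.adicCompletion ℚ) σ) T) =
      (mu ℚ (p ^ k)) (absGaloisRestrict ℚ (v.adicCompletion ℚ) σ)
        (pairingHomOfFun (p ^ k) (weilTowerPk W k) (weilTowerPk_pow W k) (weilTowerPk_add_left W k) (weilTowerPk_add_right W k) S T) := h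
  rw [GaloisRep.restrictField_apply, h']
  exact TopRep.hom_comm_apply (muLocalIso (K := ℚ) v (p ^ k)).hom σ _

include hpv hgood hord in
/-- **The induced pairing `e' : C_p[p^k] × (E[p^k] ⧸ C_p[p^k]) → μ_{p^k}(ℚ̄_p)` and its right-perfectness** (Howard's Lemma 3.1.1 at the
`E`-level, where GOOD ORDINARY reduction enters): for any bi-additive `eL` of the shape of `exists_localWeilPairing` there is `e'` with
`eL (ι c) x = e' c (π x)` (descent through the isotropy of `C = Fil_p E[p^k]`, `pairing_torsionFilAt_eq_zero_of_not_dvd_frobeniusTraceAt` and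
`weilPairingFun_self`), equivariant, and with `q ↦ e'(·, q)` BIJECTIVE: injective because `C^⊥ = C`
(`Submodule.mem_of_forall_mem_eq_zero_of_sq` with `#C·#C = #E[p^k]`, `natCard_torsionFilAt_mul_self`), surjective because every character of
`C` is `e(·, x)|_C` (`conjPairing_restricted_right_exhausting`); the non-degeneracy input is THE Weil pairing's
(`SignedLowerOffTwo.PTDeep.weilTowerPk_nondegenerate`). [cite: Howard2004HeegnerKolyvagin, Lemma 3.1.1] [cite: GreenbergLNM1716, §2 pp. 73–75]
[cite: MilneADT2006, Ch. I §0 Prop. 0.19] -/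
theorem exists_grPairing [NeZero (p ^ k)] [CompactSpace (absoluteGaloisGroup (v.adicCompletion ℚ))]
    (eL : W.geomTorsion ((p : ℤ) ^ k) →+ W.geomTorsion ((p : ℤ) ^ k) →+ MuCarrier (v.adicCompletion ℚ) (p ^ k))
    (heL : ∀ S T, eL S T = (muLocalIso (K := ℚ) v (p ^ k)).hom.hom
        (pairingHomOfFun (p ^ k) (weilTowerPk W k) (weilTowerPk_pow W k) (weilTowerPk_add_left W k) (weilTowerPk_add_right W k) S T))
    (heLsmul : ∀ (σ : absoluteGaloisGroup (v.adicCompletion ℚ)) (S T : W.geomTorsion ((p : ℤ) ^ k)),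
        eL (GaloisRep.restrictField (v.adicCompletion ℚ) (W.torsionGaloisModule ((p : ℤ) ^ k)) σ S)
            (GaloisRep.restrictField (v.adicCompletion ℚ) (W.torsionGaloisModule ((p : ℤ) ^ k)) σ T) =
          mu (v.adicCompletion ℚ) (p ^ k) σ (eL S T)) :
    ∃ e' : ↥(AddSubgroup.toIntSubmodule (W.kernelOfReductionLocalDatumTorsion ((p : ℤ) ^ k) v).plus) →+
        (W.geomTorsion ((p : ℤ) ^ k) ⧸ AddSubgroup.toIntSubmodule (W.kernelOfReductionLocalDatumTorsion ((p : ℤ) ^ k) v).plus) →+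
          MuCarrier (v.adicCompletion ℚ) (p ^ k),
      (∀ (c : ↥(AddSubgroup.toIntSubmodule (W.kernelOfReductionLocalDatumTorsion ((p : ℤ) ^ k) v).plus))
          (x : W.geomTorsion ((p : ℤ) ^ k)), eL (c : W.geomTorsion ((p : ℤ) ^ k)) x = e' c (Submodule.Quotient.mk x)) ∧
      (∀ (σ : absoluteGaloisGroup (v.adicCompletion ℚ))
          (c : ↥(AddSubgroup.toIntSubmodule (W.kernelOfReductionLocalDatumTorsion ((p : ℤ) ^ k) v).plus))
          (q : W.geomTorsion ((p : ℤ) ^ k) ⧸ AddSubgroup.toIntSubmodule (W.kernelOfReductionLocalDatumTorsion ((p : ℤ) ^ k) v).plus),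
        e' ((GaloisRep.restrictField (v.adicCompletion ℚ) (W.torsionGaloisModule ((p : ℤ) ^ k))).subrepresentation
              (AddSubgroup.toIntSubmodule (W.kernelOfReductionLocalDatumTorsion ((p : ℤ) ^ k) v).plus)
              (plus_toIntSubmodule_le_comap W ((p : ℤ) ^ k) v) σ c)
            ((GaloisRep.restrictField (v.adicCompletion ℚ) (W.torsionGaloisModule ((p : ℤ) ^ k))).quotient
              (AddSubgroup.toIntSubmodule (W.kernelOfReductionLocalDatumTorsion ((p : ℤ) ^ k) v).plus)
              (plus_toIntSubmodule_le_comap W ((p : ℤ) ^ k) v) σ q) =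
          mu (v.adicCompletion ℚ) (p ^ k) σ (e' c q)) ∧
      Function.Bijective fun q : W.geomTorsion ((p : ℤ) ^ k) ⧸
          AddSubgroup.toIntSubmodule (W.kernelOfReductionLocalDatumTorsion ((p : ℤ) ^ k) v).plus ↦ e'.flip q := by
  have hordpt := W.exists_ordinaryPoint_local_of_not_dvd_frobeniusTraceAt v hgood hpv hord
  haveI : Finite (W.geomTorsion ((p : ℤ) ^ k)) := finite_geomTorsion_of_neZero W (p ^ k)
  have hγinj : Function.Injective (muLocalIso (K := ℚ) v (p ^ k)).hom.hom := fun x y hxy ↦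
    muTransfer_injective ℚ (v.adicCompletion ℚ) (p ^ k) hxy
  -- `CharZero ℚ_v` is needed for `μ_{p^k}(ℚ̄_v) ≃ ℤ/p^k`; it is introduced only NOW, so that no `Algebra ℚ ℚ_v` instance above is
  -- resolved through `DivisionRing.toRatAlgebra` (the tree's `ℚ_v`-objects carry the completion's own algebra structure)
  haveI : CharZero (v.adicCompletion ℚ) := charZero_of_injective_algebraMap (algebraMap ℚ (v.adicCompletion ℚ)).injective
  -- the `ℤ/p^k`-valued shadow `eZ = ω ∘ eL`
  set ω : MuCarrier (v.adicCompletion ℚ) (p ^ k) →+ ZMod (p ^ k) :=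
    (muCarrierZModEquiv (v.adicCompletion ℚ) (p ^ k)).toAddMonoidHom with hω
  have hωinj : Function.Injective ω := (muCarrierZModEquiv (v.adicCompletion ℚ) (p ^ k)).injective
  set eZ : W.geomTorsion ((p : ℤ) ^ k) →+ W.geomTorsion ((p : ℤ) ^ k) →+ ZMod (p ^ k) := eL.compr₂ ω with heZ
  have heZ_apply : ∀ S T, eZ S T = ω (eL S T) := fun _ _ ↦ rfl
  -- `eZ S T = 0 ↔ e_{p^k}(S, T) = 1`
  have heZ_zero : ∀ S T, eZ S T = 0 ↔ weilTowerPk W k S T = 1 := fun S T ↦ by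
    rw [heZ_apply, map_eq_zero_iff _ hωinj, heL, map_eq_zero_iff _ hγinj, muCarrier_eq_iff, coe_pairingHomOfFun]
    rfl
  have hM : ∀ x : W.geomTorsion ((p : ℤ) ^ k), (p ^ k) • x = 0 := nsmul_geomTorsion_eq_zero W p k
  have hnd : ∀ b : W.geomTorsion ((p : ℤ) ^ k), (∀ a, eZ a b = 0) → b = 0 := fun b hb ↦
    SignedLowerOffTwo.PTDeep.weilTowerPk_nondegenerate W k b fun a ↦ (heZ_zero a b).1 (hb a)
  have hiso : ∀ a ∈ AddSubgroup.toIntSubmodule (W.kernelOfReductionLocalDatumTorsion ((p : ℤ) ^ k) v).plus,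
      ∀ a' ∈ AddSubgroup.toIntSubmodule (W.kernelOfReductionLocalDatumTorsion ((p : ℤ) ^ k) v).plus, eZ a a' = 0 := by
    rw [← torsionFilAt_eq_toIntSubmodule_plus]
    refine W.pairing_torsionFilAt_eq_zero_of_not_dvd_frobeniusTraceAt v hgood hpv hord k eZ fun a ↦ ?_
    rw [heZ_zero]
    exact weilPairingFun_self (natCast_pow_prime_ne_zero (p := p) k) (zsmul_coe_geomTorsion_pow W k a)
  have hcard : Nat.card (AddSubgroup.toIntSubmodule (W.kernelOfReductionLocalDatumTorsion ((p : ℤ) ^ k) v).plus) *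
      Nat.card (AddSubgroup.toIntSubmodule (W.kernelOfReductionLocalDatumTorsion ((p : ℤ) ^ k) v).plus) =
      Nat.card (W.geomTorsion ((p : ℤ) ^ k)) := by
    rw [← torsionFilAt_eq_toIntSubmodule_plus]
    exact W.natCard_torsionFilAt_mul_self v hgood hpv hordpt k
  -- descent of `eL c` through the quotient
  have hker : ∀ c : ↥(AddSubgroup.toIntSubmodule (W.kernelOfReductionLocalDatumTorsion ((p : ℤ) ^ k) v).plus),
      AddSubgroup.toIntSubmodule (W.kernelOfReductionLocalDatumTorsion ((p : ℤ) ^ k) v).plus ≤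
        LinearMap.ker (eL (c : W.geomTorsion ((p : ℤ) ^ k))).toIntLinearMap := fun c x hx ↦ by
    rw [LinearMap.mem_ker, AddMonoidHom.coe_toIntLinearMap, ← map_eq_zero_iff _ hωinj, ← heZ_apply]
    exact hiso c c.2 x hx
  obtain ⟨e', he'⟩ : ∃ e' : ↥(AddSubgroup.toIntSubmodule (W.kernelOfReductionLocalDatumTorsion ((p : ℤ) ^ k) v).plus) →+
      (W.geomTorsion ((p : ℤ) ^ k) ⧸ AddSubgroup.toIntSubmodule (W.kernelOfReductionLocalDatumTorsion ((p : ℤ) ^ k) v).plus) →+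
        MuCarrier (v.adicCompletion ℚ) (p ^ k),
      ∀ (c : ↥(AddSubgroup.toIntSubmodule (W.kernelOfReductionLocalDatumTorsion ((p : ℤ) ^ k) v).plus))
        (x : W.geomTorsion ((p : ℤ) ^ k)), e' c (Submodule.Quotient.mk x) = eL (c : W.geomTorsion ((p : ℤ) ^ k)) x :=
    ⟨AddMonoidHom.mk' (fun c ↦ ((AddSubgroup.toIntSubmodule (W.kernelOfReductionLocalDatumTorsion ((p : ℤ) ^ k) v).plus).liftQ
      (eL (c : W.geomTorsion ((p : ℤ) ^ k))).toIntLinearMap (hker c)).toAddMonoidHom) (fun c₁ c₂ ↦ by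
        ext q
        induction q using Submodule.Quotient.induction_on with
        | _ x =>
          simp only [AddMonoidHom.add_apply, LinearMap.toAddMonoidHom_coe, Submodule.liftQ_apply,
            AddMonoidHom.coe_toIntLinearMap, Submodule.coe_add, map_add]),
      fun _ _ ↦ rfl⟩
  refine ⟨e', fun c x ↦ (he' c x).symm, fun σ c q ↦ ?_, ?_⟩
  · induction q using Submodule.Quotient.induction_on with
    | _ x =>
      rw [ContinuousRep.quotient_apply_mk, he', he', ContinuousRep.subrepresentation_apply_coe, heLsmul]
  · constructor
    · -- injective: `C^⊥ = C`
      intro q₁ q₂ h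
      induction q₁ using Submodule.Quotient.induction_on with
      | _ x₁ =>
        induction q₂ using Submodule.Quotient.induction_on with
        | _ x₂ =>
          rw [Submodule.Quotient.eq]
          refine Literature.NumberTheory.EllipticCurves.Submodule.mem_of_forall_mem_eq_zero_of_sq eZ _ hM hnd hiso hcard
            fun a ha ↦ ?_
          have h' := DFunLike.congr_fun h ⟨a, ha⟩
          simp only [AddMonoidHom.flip_apply, he'] at h'
          rw [heZ_apply, map_sub, h', sub_self, map_zero]
    · -- surjective: every character of `C` is `e(·, x)|_C`
      intro ψ
      obtain ⟨x, hx⟩ := conjPairing_restricted_right_exhausting eZ (AddMonoidHom.id _)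
        (AddSubgroup.toIntSubmodule (W.kernelOfReductionLocalDatumTorsion ((p : ℤ) ^ k) v).plus)
        (AddSubgroup.toIntSubmodule (W.kernelOfReductionLocalDatumTorsion ((p : ℤ) ^ k) v).plus)
        (fun _ h ↦ h) (fun y hy ↦ ⟨y, hy, rfl⟩) (fun _ ↦ rfl) hM hnd hiso hcard (ω.comp ψ)
      refine ⟨Submodule.Quotient.mk x, ?_⟩
      ext c
      apply hωinj
      have hfl : (e'.flip (Submodule.Quotient.mk x)) c = e' c (Submodule.Quotient.mk x) := rfl
      rw [hfl, he', ← heZ_apply]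
      exact hx c

end LocalPairing

/-! ## §3 The socket's `hLdual` -/

section Dual

variable (W : WeierstrassCurve ℚ) [W.IsElliptic] (p : ℕ) [hp : Fact p.Prime] (κ : ZpExtension ℚ p) (hκ : κ.IsCyclotomic) (n k : ℕ)
  [Fintype (absoluteGaloisGroup ℚ ⧸ κ.layerSubgroup n)]
  {s : absoluteGaloisGroup ℚ ⧸ κ.layerSubgroup n → absoluteGaloisGroup ℚ}
  (hs : ∀ x : absoluteGaloisGroup ℚ ⧸ κ.layerSubgroup n, (s x : absoluteGaloisGroup ℚ ⧸ κ.layerSubgroup n) = x)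
  (hs1 : s ((1 : absoluteGaloisGroup ℚ) : absoluteGaloisGroup ℚ ⧸ κ.layerSubgroup n) = 1)
  (v : HeightOneSpectrum (𝓞 ℚ)) (hpv : ((p : ℕ) : 𝓞 ℚ) ∈ v.asIdeal) (hgood : W.HasGoodReductionAt v)
  (hord : ¬ ((p : ℤ) ∣ W.frobeniusTraceAt v))

set_option maxHeartbeats 800000 in -- the explicit local modules make the unifications of the Lagrangian call expensive
include hκ hpv hgood hord in
/-- **Socket (HP), the dual half `hLdual`.** `K = ℚ`, `p` of GOOD ORDINARY reduction (`p ∤ a_p`), `κ` cyclotomic, `M = E[p^k]`,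
`Γ_n = κ.layerSubgroup n`, `U_n = layerGroup κ p n`, `Q = M| ⧸ C_p[p^k]`, `Lp p` as in the sibling file. For a layer class `b ∈ H¹(Γ_n, M)`:
if `loc_p(Ψ_*(Sh b))` lies in the dual local condition of `Lp p` for THE canonical invariant maps (the hypothesis shape `hLdual` of
`TorsionEulerChar.H46Levelwise.exists_layerClass_prescribed_of_orthogonal`), then `b ∈ (W.kernelOfReductionLocalDatumTorsion (p^k) p).strictKer Γ_n`
(`= Λp p b`). [cite: GreenbergLNM1716, §2 pp. 73–75, §4 Lemma 4.6 (p. 105)] [cite: MilneADT2006, Ch. I Cor. 2.3] [cite: Howard2004HeegnerKolyvagin, Lemma 3.1.1] -/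
theorem mem_strictKer_of_localization_coindTateDual_mem_dualLocalCondition [NeZero (p ^ k)]
    [Finite (W.geomTorsion ((p : ℤ) ^ k))] [CompactSpace (absoluteGaloisGroup ℚ)]
    [CompactSpace (absoluteGaloisGroup (v.adicCompletion ℚ))] (b : W.torsionH1Over ((p : ℤ) ^ k) (κ.layerSubgroup n))
    (hdual : galoisCohomology.localization
        (((W.torsionGaloisModule ((p : ℤ) ^ k)).coind (κ.layerSubgroup n) (κ.isOpen_layerSubgroup n)).tateDual (p ^ k))
        (Sum.inr v) 1
        (cohomologyMap (coindTateDualMor (W.torsionGaloisModule ((p : ℤ) ^ k)) (W.torsionGaloisModule ((p : ℤ) ^ k))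
            (κ.layerSubgroup n)
            (pairingHomOfFun (p ^ k) (weilTowerPk W k) (weilTowerPk_pow W k) (weilTowerPk_add_left W k) (weilTowerPk_add_right W k))
            (κ.isOpen_layerSubgroup n)
            (fun σ a b => (contPairingOfFun (W.torsionGaloisModule ((p : ℤ) ^ k)) (p ^ k) (weilTowerPk W k) (weilTowerPk_pow W k)
              (weilTowerPk_add_left W k) (weilTowerPk_add_right W k) (weilTowerPk_smul W k)).toLin_smul σ a b)) 1
          (shapiroLift (W.torsionGaloisModule ((p : ℤ) ^ k)).toTopRep (κ.layerSubgroup n) (κ.isOpen_layerSubgroup n) hs hs1 b)) ∈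
      (LocalInvariants.canonical ℚ (p ^ k)).dualLocalCondition
        ((W.torsionGaloisModule ((p : ℤ) ^ k)).coind (κ.layerSubgroup n) (κ.isOpen_layerSubgroup n)) (Sum.inr v)
        (AddSubgroup.comap
          (cohomologyMap (coindFinPull (W.torsionGaloisModule ((p : ℤ) ^ k)).toTopRep (κ.layerSubgroup n)
            (resGalOfEmb (closureEmb (K := ℚ) (v.adicCompletion ℚ))) (X' := localRepOf (W.torsionGaloisModule ((p : ℤ) ^ k)) v)
            (TopRep.ofHom ⟨ContinuousLinearMap.id ℤ (W.geomTorsion ((p : ℤ) ^ k)), fun _ => rfl⟩) (layerGroup κ v n)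
            (fun _ h => h)) 1).hom.toLinearMap.toAddMonoidHom
          (AddSubgroup.map (layerShapiroOf (W.torsionGaloisModule ((p : ℤ) ^ k)) κ v n).toAddMonoidHom
            (cohomologyMap (subgroupRepMap
              (ContinuousRep.mkQHom (GaloisRep.restrictField (v.adicCompletion ℚ) (W.torsionGaloisModule ((p : ℤ) ^ k)))
                (AddSubgroup.toIntSubmodule (W.kernelOfReductionLocalDatumTorsion ((p : ℤ) ^ k) v).plus)
                (plus_toIntSubmodule_le_comap W ((p : ℤ) ^ k) v)) (layerGroup κ v n)) 1).hom.toLinearMap.toAddMonoidHom.ker))) :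
    b ∈ (W.kernelOfReductionLocalDatumTorsion ((p : ℤ) ^ k) v).strictKer (κ.layerSubgroup n) := by
  -- `CharZero ℚ_v` is passed to the local-duality lemma EXPLICITLY (never as a local instance): with it in scope, `Algebra ℚ ℚ_v` would be
  -- resolved through `DivisionRing.toRatAlgebra` instead of the completion's own structure carried by all the tree's `ℚ_v`-objects
  letI : Fintype (absoluteGaloisGroup (v.adicCompletion ℚ) ⧸ layerGroup κ v n) := layerFintypeQuot κ v n
  refine mem_strictKer_of_cohomologyMap_mkQHom_layerLocOf_eq_zero W ((p : ℤ) ^ k) κ n v b ?_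
  obtain ⟨eL, heL, heLsmul⟩ := exists_localWeilPairing W p k v
  obtain ⟨e', he'compat, he'smul, he'bij⟩ := exists_grPairing W p k v hpv hgood hord eL heL heLsmul
  refine @cohomologyMap_eq_zero_of_forall_cupProduct_shapiroLift_range_eq_zero (v.adicCompletion ℚ) _ _ _ _
    (charZero_of_injective_algebraMap (algebraMap ℚ (v.adicCompletion ℚ)).injective) _ _ _ _ _ _ _ _ _ _ _ _ _
    ((GaloisRep.restrictField (v.adicCompletion ℚ) (W.torsionGaloisModule ((p : ℤ) ^ k))).subrepresentation
      (AddSubgroup.toIntSubmodule (W.kernelOfReductionLocalDatumTorsion ((p : ℤ) ^ k) v).plus)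
      (plus_toIntSubmodule_le_comap W ((p : ℤ) ^ k) v))
    (GaloisRep.restrictField (v.adicCompletion ℚ) (W.torsionGaloisModule ((p : ℤ) ^ k)))
    ((GaloisRep.restrictField (v.adicCompletion ℚ) (W.torsionGaloisModule ((p : ℤ) ^ k))).quotient
      (AddSubgroup.toIntSubmodule (W.kernelOfReductionLocalDatumTorsion ((p : ℤ) ^ k) v).plus)
      (plus_toIntSubmodule_le_comap W ((p : ℤ) ^ k) v))
    (subtypeHom (GaloisRep.restrictField (v.adicCompletion ℚ) (W.torsionGaloisModule ((p : ℤ) ^ k)))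
      (AddSubgroup.toIntSubmodule (W.kernelOfReductionLocalDatumTorsion ((p : ℤ) ^ k) v).plus)
      (plus_toIntSubmodule_le_comap W ((p : ℤ) ^ k) v))
    (ContinuousRep.mkQHom (GaloisRep.restrictField (v.adicCompletion ℚ) (W.torsionGaloisModule ((p : ℤ) ^ k)))
      (AddSubgroup.toIntSubmodule (W.kernelOfReductionLocalDatumTorsion ((p : ℤ) ^ k) v).plus)
      (plus_toIntSubmodule_le_comap W ((p : ℤ) ^ k) v))
    (layerGroup κ v n) _ (isOpen_layerGroup κ v n) _ (layerReps_spec κ v n) (layerReps_one κ v n) _ _ eL heLsmul e' he'smul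
    he'bij (fun c x ↦ he'compat c x) (fun c ↦ Subtype.ext (by
      rw [Submodule.coe_smul_of_tower, Submodule.coe_zero]; exact nsmul_geomTorsion_eq_zero W p k _))
    (layerLocOf (W.torsionGaloisModule ((p : ℤ) ^ k)) κ v n b) fun c ↦ ?_
  -- the local class `x = ι_* c` dies under `π_*`
  have hx0 : cohomologyMap (subgroupRepMap
      (ContinuousRep.mkQHom (GaloisRep.restrictField (v.adicCompletion ℚ) (W.torsionGaloisModule ((p : ℤ) ^ k)))
        (AddSubgroup.toIntSubmodule (W.kernelOfReductionLocalDatumTorsion ((p : ℤ) ^ k) v).plus)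
        (plus_toIntSubmodule_le_comap W ((p : ℤ) ^ k) v)) (layerGroup κ v n)) 1
      (cohomologyMap (subgroupRepMap (subtypeHom (GaloisRep.restrictField (v.adicCompletion ℚ)
        (W.torsionGaloisModule ((p : ℤ) ^ k)))
        (AddSubgroup.toIntSubmodule (W.kernelOfReductionLocalDatumTorsion ((p : ℤ) ^ k) v).plus)
        (plus_toIntSubmodule_le_comap W ((p : ℤ) ^ k) v)) (layerGroup κ v n)) 1 c) = 0 := by
    obtain ⟨f, rfl⟩ := oneCocycleClass_surjective _ c
    rw [cohomologyMap_oneCocycleClass, cohomologyMap_oneCocycleClass, oneCocycleClass_eq_zero_iff]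
    refine ⟨0, fun g ↦ ?_⟩
    rw [map_zero, sub_zero, pullback_id_resIdHom_apply, pullback_id_resIdHom_apply]
    exact (Submodule.Quotient.mk_eq_zero _).2 (f.1 g).2
  -- `a := pull_p⁻¹ (Sh_loc x)` lies in `Lp p`
  obtain ⟨a, ha⟩ := (ThetaTransport.CoindShapiroOfFun.bijective_cohomologyMap_coindFinPull
    (W.torsionGaloisModule ((p : ℤ) ^ k)) κ v hκ hpv n 1).2
    (layerShapiroOf (W.torsionGaloisModule ((p : ℤ) ^ k)) κ v n
      (cohomologyMap (subgroupRepMap (subtypeHom (GaloisRep.restrictField (v.adicCompletion ℚ)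
        (W.torsionGaloisModule ((p : ℤ) ^ k)))
        (AddSubgroup.toIntSubmodule (W.kernelOfReductionLocalDatumTorsion ((p : ℤ) ^ k) v).plus)
        (plus_toIntSubmodule_le_comap W ((p : ℤ) ^ k) v)) (layerGroup κ v n)) 1 c))
  have h0 := (LocalInvariants.mem_dualLocalCondition_iff _ _ _ _ _).1 hdual a
    (AddSubgroup.mem_comap.mpr (AddSubgroup.mem_map.mpr ⟨_, (AddMonoidHom.mem_ker).mpr hx0, ha.symm⟩))
  -- RTT's dictionary: the pairing is `inv_p` of the layer cup product
  rw [ThetaTransport.CoindShapiroOfFun.localTatePairingZMod_canonical_localization_coindTateDual_shapiroLift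
    (W.torsionGaloisModule ((p : ℤ) ^ k)) (p ^ k) (weilTowerPk W k) (weilTowerPk_pow W k) (weilTowerPk_add_left W k)
    (weilTowerPk_add_right W k) (weilTowerPk_smul W k) κ v hκ hpv n hs hs1 a b, ha] at h0
  have h1 := invAt_injective v (p ^ k) (h0.trans (map_zero _).symm)
  -- μ-transport to the local coefficients
  have hc : ∀ x y, (muLocalIso (K := ℚ) v (p ^ k)).hom.hom
      ((layerSumPairingOf (W.torsionGaloisModule ((p : ℤ) ^ k)) (p ^ k) (weilTowerPk W k) (weilTowerPk_pow W k)
        (weilTowerPk_add_left W k) (weilTowerPk_add_right W k) (weilTowerPk_smul W k) κ v n).toLin x y) =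
      ((pairing (GaloisRep.restrictField (v.adicCompletion ℚ) (W.torsionGaloisModule ((p : ℤ) ^ k)))
        (GaloisRep.restrictField (v.adicCompletion ℚ) (W.torsionGaloisModule ((p : ℤ) ^ k))) (mu (v.adicCompletion ℚ) (p ^ k))
        eL heLsmul).coindFin (layerGroup κ v n)).toLin x y := fun x y ↦ by
    rw [layerSumPairingOf, ContPairing.coindFin_toLin_apply, ContPairing.coindFin_toLin_apply, map_sum]
    exact Finset.sum_congr rfl fun z _ ↦ by rw [localPairingOfFun_toLin_apply, pairing_toLin_apply, heL]
  have h2 := ContPairing.cupProduct_map_adjoint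
    (layerSumPairingOf (W.torsionGaloisModule ((p : ℤ) ^ k)) (p ^ k) (weilTowerPk W k) (weilTowerPk_pow W k)
      (weilTowerPk_add_left W k) (weilTowerPk_add_right W k) (weilTowerPk_smul W k) κ v n)
    ((pairing (GaloisRep.restrictField (v.adicCompletion ℚ) (W.torsionGaloisModule ((p : ℤ) ^ k)))
      (GaloisRep.restrictField (v.adicCompletion ℚ) (W.torsionGaloisModule ((p : ℤ) ^ k))) (mu (v.adicCompletion ℚ) (p ^ k))
      eL heLsmul).coindFin (layerGroup κ v n))
    (𝟙 _) (𝟙 _) (muLocalIso (K := ℚ) v (p ^ k)).hom (fun x y ↦ hc x y)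
    (layerShapiroOf (W.torsionGaloisModule ((p : ℤ) ^ k)) κ v n
      (cohomologyMap (subgroupRepMap (subtypeHom (GaloisRep.restrictField (v.adicCompletion ℚ)
        (W.torsionGaloisModule ((p : ℤ) ^ k)))
        (AddSubgroup.toIntSubmodule (W.kernelOfReductionLocalDatumTorsion ((p : ℤ) ^ k) v).plus)
        (plus_toIntSubmodule_le_comap W ((p : ℤ) ^ k) v)) (layerGroup κ v n)) 1 c))
    (layerShapiroOf (W.torsionGaloisModule ((p : ℤ) ^ k)) κ v n (layerLocOf (W.torsionGaloisModule ((p : ℤ) ^ k)) κ v n b))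
  rw [cohomologyMap_id_apply, cohomologyMap_id_apply, h1, map_zero] at h2
  exact h2.symm

end Dual

end TorsionEulerChar.H46AtP

end Summit.BirchSwinnertonDyer.BirchSwinnertonDyer.Theorems

end
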